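import Summits.Ventures.PercRepro.RankLevelSetLevelSixHeavySq31F
import Summits.Ventures.PercRepro.RankLevelSetLevelFiveThree30

/-!
# PercRepro — C-025 AT LEVEL `6` FOR EVERY `p ≥ 31`, EVERY FINITE MATROID, UNCONDITIONAL (p8 g4, S3 §3q′)

`proofs/SUBCLAIM-S3-p8.md` §3q′. `c025_six_of_five_heavy_sq31f` (RankLevelSetLevelSixHeavySq31F: the multiplicity `15` at
`ν = 3`, the disjoint pair count, the size-capped heavy term, p2's LEMMA Q, p1's T⁺⁺⁺ and the 4-circuit table) on p7's
level-`5` row `c025_five_large_three30 (30 ≤ p)` (RankLevelSetLevelFiveThree30). One line; its closure is the union of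
the two closures of RankLevelSetLevelSixHeavySq31F and p7's closure of LevelFiveThree30 (2b4d027efca06cd7). NOT farm-checked
on seat (its parents' oleans are absent); the gate's kernel check at landing is the check. Axioms: standard.
-/

open scoped Matroid

namespace PercRepro

namespace ThmN

variable {α : Type}

/-- **C-025 AT LEVEL `6` FOR EVERY `p ≥ 31`, EVERY FINITE MATROID, UNCONDITIONAL** — `c025_six_of_five_heavy_sq31f` on
p7's level-`5` row `c025_five_large_three30 (30 ≤ p)`. -/
theorem c025_six_large_thirty_one (M : Matroid α) [M.Finite] (p : ℕ) (hp : 31 ≤ p) : RLS M p 6 :=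
  c025_six_of_five_heavy_sq31f (fun M _ p hp => c025_five_large_three30 M p (by omega)) M p hp

/-- The same in the vocabulary of `C025`: the level-`6` frontier is every `p ≥ 31`. -/
theorem c025_six_large_thirty_one' (M : Matroid α) [M.Finite] (p : ℕ) (hp : 31 ≤ p) :
    phiK p 6 * ({A : Set α | A ⊆ M.E ∧ M.eRk A = (p : ℕ∞) ∧ M.eRk (M.E \ A) = (6 : ℕ∞)}.ncard : ℚ) ≤
      ({A : Set α | A ⊆ M.E ∧ (6 : ℕ∞) < M.eRk A ∧ M.eRk A < (p : ℕ∞)}.ncard : ℚ) :=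
  c025_six_large_thirty_one M p hp

end ThmN

end PercRepro
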